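import Summits.QuantumFields.BalabanUV.Beta.FP.BlockAveragedRemainder
import Summits.QuantumFields.BalabanUV.Beta.FP.BlockAveragedKernelAxial
import Summits.QuantumFields.BalabanUV.Beta.FP.ConstrainedGhostIRLetters

/-!
# Road FP (binder row D1), row H′2-IR — «IR-Q» PART B: THE INSTANCE AT BAŁABAN's STRAIGHT-CONTOUR BLOCK AVERAGE
# (`AxialComposition.axialAvg`): the leg letters (A0)∕(A1) IN COARSE UNITS and the within-block oscillation (OSC) of `A = P Q_nᵀ` for an
# ARBITRARY graded kernel family `P`, hence `|R^Q| ≤ C·n⁻²`, `|Δ_x R^Q| ≤ C·n⁻³` for an ARBITRARY coarse inverse `G` with displayed letters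

HONEST DEPENDENCY (page 1, mandatory): continuum YM on T⁴ ⇐ BetaPertH ∧ nine spine estimates (0/9 proved); BetaPertH ⇐ (D1) ∧ (D4) ∧
CAP+tail; G-an2-4 gates asym, D1 and NE2/3/4.  HONEST FRAMING (cell contract, verbatim): «discharging `BetaPertH` makes Bałaban's UV
stability UNCONDITIONAL — a real constructive-QFT result; it is NOT the continuum limit and NOT the Clay problem.»  THIS MODULE is
elementary real analysis on `ℤ⁴` sums (our bookkeeping): PART A `FP/BlockAveragedRemainder` (the (ε) cancellation + superposition), this
lineage's IR-1-ABS PART 3 `FP/BlockAveragedKernelAxial` (`abs_axialAvg_le_profile`, `abs_axialAvg_fwdDiff_le_profile`), leaf-05-g9's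
`FP/ConstrainedGhostIRLetters` §1 (fine ⟹ coarse profile conversion `coarse_le`) and `FP/LatticeTaylorPath.abs_taylor0D_le`, all BY NAME; it cites
nothing, declares no `def`, mints no `def … : Prop`, has 0 `sorry`.  The averaging operation is the TREE's `AxialComposition.axialAvg` (an3-g5's
transcription of [Balaban1984PropagatorsI] (1.11)∕(1.18) — a DEFINITION read by name; nothing printed is a hypothesis).  The kernel family `P`
(the perfect BF propagator's entries on the road) and the coarse inverse `G` (road: `G_C = (Q_nP^{BF}Q_nᵀ)⁻¹`) are ARBITRARY with DISPLAYED
letters; the module proves NO estimate of either and discharges NOTHING of row H′2-IR ∕ `ρ_a` ∕ `hasym` ∕ D1 ∕ `BetaPertH`; NEVER «G-an2-4 closed»;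
NOT (CONV-C), NOT D1, NOT the continuum limit, NOT Clay.

ABSOLUTE RULE (cell charter, verbatim): «No internally-minted statement may enter as a cited fact. Every hypothesis is either
kernel-proved in this package or a verbatim quotation of a PUBLISHED theorem with page reference. The manuscript(s) under audit are NOT
citable for their own disputed steps — they are the thing under adjudication; programme-internal (2001/route/tribunal) claims are never
citable.»

OBJECTS (blocking `n ≥ 1`, `Pt = ℤ⁴` sup norm, directions `Fin 4`, MASS-ONE normalisation — `R^Q` is invariant under `Q ↦ cQ`, E-FP-5-3):
the leg `A((x,μ),(u,α)) := axialAvg n α (v ↦ P μ α (x − v)) u` (`= (P Q_nᵀ)`), the coarse covariance `C_n((w,ν),(v,β)) := axialAvg n ν (y′ ↦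
axialAvg n β (t ↦ P ν β (y′ − t)) v) w` (`= Q_nPQ_nᵀ`; on the direction diagonal it is `AxialComposition.covAvg`), an arbitrary `G`.
LETTERS (hypotheses; suppliers): (P0) `|P μ α z| ≤ C₀∕(‖z‖∞+1)²`, (P1) `|P μ α (z+e_i) − P μ α z| ≤ C₁∕(‖z‖∞+1)³` [H2-P-KER-ASM (K0)(K1)(K2′) +
`TwoPowerLegs.free` through PART 5 `BlockAveragedKernelLegs`]; (G-poly) `|G α β u v| ≤ κ∕(‖u−v‖∞+1)⁵` [IR-2 (v); exponential ⟹ polynomial by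
`LatticeConvolutionBounds.exp_neg_supNorm_le_div_pow`]; (G-inv) `∀ w ν α u, HasSum (v ↦ Σ_β G α β u v·C_n((w,ν),(v,β))) [u = w ∧ α = ν]`
[IR-2 (iv)(v): `G_C·C_n = 1` with `C_n` symmetric ((K4))].
CONTENT. §1 `fine_le_coarse` (`c∕(2n+1+‖x−n•u‖∞)^a ≤ (2^a c∕n^a)∕(‖u − quo n x‖∞+1)^a`); §2 (A0) `leg_letter` (`a₀ = 36·531442·C₀∕n²`, degree 2),
(A1) `leg_diff_letter` (`216·531442·C₁∕n³`, degree 3); §3 (OSC) **`leg_osc_letter`** (`a₁ = 13824·531442·C₁∕n²`: the contour block of `(quo n y, ν)`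
lies within `2n` of `y` coordinatewise — a lattice path, `abs_taylor0D_le`); §4 **(W)∕(T0)∕(T1) FOR `R^Q`**: `abs_multQ_le`, **`abs_remQ_le`**
(`|R^Q((x,μ),(y,ν))| ≤ 4·162·(36·531442·C₀∕n²)·(4·1296·κ·(13824·531442·C₁∕n²) + 1)`, i.e. `≍ C₀(κn⁻²C₁ + 1)·n⁻²` = E-FP-5-2's `n^{2−d}` at
`κ ≍ n²`), **`abs_remQ_sub_le`** (x-differences, `≍ n⁻³`) — GLOBAL in `(x, y)` like IR-4's (T0)∕(T1).
Unit `b2b-balaban-gan24-formalise-leaf-04` (gen 40; cross-lane idle G-an2-4 swarm leaf seat on road FP), 2026-08-20; journal INTENT «IR-Q» l.22072.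
-/

namespace Summit.QuantumFields.BalabanUV.Beta.FP.BlockAveragedRemainderAxial

open Finset fwdDiff
open scoped BigOperators
open Literature.MathematicalPhysics.QuantumFieldTheory.Balaban1983to89.Beta
open Literature.MathematicalPhysics.QuantumFieldTheory.Balaban1983to89.Beta.DyadicShell (Pt supNorm supNorm_le_iff natAbs_le_supNorm
  natAbs_le_iff_mem supNorm_eq_zero_iff)
open Literature.MathematicalPhysics.QuantumFieldTheory.Balaban1983to89.Beta.GradedBubbles (supNorm_neg)
open Literature.MathematicalPhysics.QuantumFieldTheory.Balaban1983to89.Beta.BlockLegs (supNorm_sub_le_real supNorm_add_le_real)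
open Literature.MathematicalPhysics.QuantumFieldTheory.Balaban1983to89.Beta.AxialBlockWeights (idx pt pt_apply fineBlock mem_fineBlock card_idx)
open Literature.MathematicalPhysics.QuantumFieldTheory.Balaban1983to89.Beta.AxialComposition (axialAvg)
open Literature.MathematicalPhysics.QuantumFieldTheory.LatticeForm (quo red red_add_smul_quo)
open Summit.QuantumFields.BalabanUV.Beta.FP.LatticeConvolutionBounds (nonneg_of_abs_le_div one_le_supNorm_add_one)
open Summit.QuantumFields.BalabanUV.Beta.FP.LatticeTaylorPath (abs_taylor0D_le)
open Summit.QuantumFields.BalabanUV.Beta.FP.BlockAveragedKernel (letter_nonneg_of_le)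
open Summit.QuantumFields.BalabanUV.Beta.FP.BlockAveragedKernelAxial (abs_axialAvg_le_profile abs_axialAvg_fwdDiff_le_profile)
open Summit.QuantumFields.BalabanUV.Beta.FP.ConstrainedGhostIRLetters (coarse_le red_bounds zsmul_natCast_eq_nsmul)
open Summit.QuantumFields.BalabanUV.Beta.FP.BlockAveragedRemainder (abs_mult_le abs_rem_le_of_letters abs_sum_rem_le_of_letters)

noncomputable section

/-! ## §1 Fine ⟹ coarse profile at the axial scale -/

/-- [our bookkeeping] **FINE ⟹ COARSE**: `c∕(2n + 1 + ‖x − n•u‖∞)^a ≤ (2^a·c∕n^a)∕(‖u − quo n x‖∞ + 1)^a` for `c ≥ 0`, `n ≥ 1`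
(leaf-05-g9's `coarse_le`: `n·(‖quo n x − u‖∞+1) ≤ 2·(n + 1 + ‖x − n•u‖∞)`). -/
theorem fine_le_coarse {n : ℕ} (hn : 1 ≤ n) (x u : Pt) (a : ℕ) {c : ℝ} (hc : 0 ≤ c) :
    c / ((((2 * n : ℕ) : ℝ)) + 1 + supNorm (x - n • u)) ^ a
      ≤ (2 ^ a * c / (n : ℝ) ^ a) / ((supNorm (u - quo n x) : ℝ) + 1) ^ a := by
  have hn0 : (0 : ℝ) < n := by exact_mod_cast hn
  have hco := coarse_le hn x u
  rw [zsmul_natCast_eq_nsmul] at hco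
  have hsym : (supNorm (u - quo n x) : ℝ) = supNorm (quo n x - u) := by rw [← supNorm_neg, neg_sub]
  rw [hsym]
  set m : ℝ := (supNorm (quo n x - u) : ℝ) + 1 with hm
  set D : ℝ := (((2 * n : ℕ) : ℝ)) + 1 + supNorm (x - n • u) with hD
  have hm0 : 0 < m := by positivity
  have hD0 : 0 < D := by positivity
  have hle : (n : ℝ) * m ≤ 2 * D := by
    refine hco.trans ?_
    rw [hD]; push_cast; nlinarith [(Nat.cast_nonneg (supNorm (x - n • u)) : (0 : ℝ) ≤ _)]
  rw [div_div, div_le_div_iff₀ (by positivity) (by positivity)]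
  calc c * ((n : ℝ) ^ a * m ^ a) = c * ((n : ℝ) * m) ^ a := by rw [mul_pow]
    _ ≤ c * (2 * D) ^ a := by gcongr
    _ = 2 ^ a * c * D ^ a := by rw [mul_pow]; ring

/-! ## §2 The leg letters (A0), (A1) in coarse units -/

/-- **(A0) THE LEG LETTER** [our bookkeeping]: `|P μ α z| ≤ C₀∕(‖z‖∞+1)²` ⟹
`|axialAvg n α (v ↦ P μ α (x − v)) u| ≤ (36·531442·C₀∕n²)∕(‖u − quo n x‖∞+1)²`. -/
theorem leg_letter {P : Fin 4 → Fin 4 → Pt → ℝ} {C₀ : ℝ} (hP0 : ∀ μ α z, |P μ α z| ≤ C₀ / ((supNorm z : ℝ) + 1) ^ 2)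
    {n : ℕ} (hn : 1 ≤ n) (μ : Fin 4) (x : Pt) (α : Fin 4) (u : Pt) :
    |axialAvg n α (fun v => P μ α (x - v)) u| ≤ (36 * 531442 * C₀ / (n : ℝ) ^ 2) / ((supNorm (u - quo n x) : ℝ) + 1) ^ 2 := by
  have hC : 0 ≤ C₀ := letter_nonneg_of_le (hP0 μ α)
  have h := abs_axialAvg_le_profile (a := 2) (by norm_num) (hP0 μ α) hn α x u
  refine h.trans ?_
  have h2 := fine_le_coarse hn x u 2 (c := 3 ^ 2 * 531442 * C₀) (by positivity)
  refine h2.trans (le_of_eq ?_)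
  ring

/-- **(A1) THE LEG's x-DIFFERENCE LETTER** [our bookkeeping]: `|P μ α (z+e_i) − P μ α z| ≤ C₁∕(‖z‖∞+1)³` ⟹
`|axialAvg n α (v ↦ P μ α (x + e_i − v)) u − axialAvg n α (v ↦ P μ α (x − v)) u| ≤ (216·531442·C₁∕n³)∕(‖u − quo n x‖∞+1)³`. -/
theorem leg_diff_letter {P : Fin 4 → Fin 4 → Pt → ℝ} {C₁ : ℝ}
    (hP1 : ∀ μ α (i : Fin 4) z, |P μ α (z + Pi.single i 1) - P μ α z| ≤ C₁ / ((supNorm z : ℝ) + 1) ^ 3)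
    {n : ℕ} (hn : 1 ≤ n) (μ : Fin 4) (x : Pt) (i : Fin 4) (α : Fin 4) (u : Pt) :
    |axialAvg n α (fun v => P μ α (x + Pi.single i 1 - v)) u - axialAvg n α (fun v => P μ α (x - v)) u|
      ≤ (216 * 531442 * C₁ / (n : ℝ) ^ 3) / ((supNorm (u - quo n x) : ℝ) + 1) ^ 3 := by
  have hC : 0 ≤ C₁ := letter_nonneg_of_le (K := fun z => P μ α (z + Pi.single i 1) - P μ α z) (hP1 μ α i)
  have h := abs_axialAvg_fwdDiff_le_profile (a := 2) (by norm_num) i (hP1 μ α i) hn α x u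
  refine h.trans ?_
  have h2 := fine_le_coarse hn x u 3 (c := 3 ^ (2 + 1) * 531442 * C₁) (by positivity)
  refine h2.trans (le_of_eq ?_)
  ring

/-! ## §3 The within-block oscillation (OSC) -/

/-- [folklore] The points of the contour block of `(quo n y, ν)` lie within `2n` of `y` in every coordinate:
for `q ∈ idx n`, `|(n • quo n y + pt ν q − y) i| ≤ 2n`. -/
theorem abs_contour_sub_le {n : ℕ} (hn : 1 ≤ n) (y : Pt) (ν : Fin 4) {q : Pt × ℕ} (hq : q ∈ idx n) (i : Fin 4) :
    |(n • quo n y + pt ν q - y) i| ≤ ((2 * n : ℕ) : ℤ) := by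
  have hy := congrArg (fun f : Pt => f i) (red_add_smul_quo n y)
  simp only [Pi.add_apply, Pi.smul_apply, smul_eq_mul] at hy
  have hr := red_bounds (N := n) (by omega) y i
  simp only [idx, Finset.mem_product, Finset.mem_range] at hq
  have hq1 := (mem_fineBlock.mp hq.1) i
  have hq2 : q.2 < n := hq.2
  have hpt := pt_apply ν q i
  have hns : (n • quo n y) i = (n : ℤ) * quo n y i := by simp
  have e : (n • quo n y + pt ν q - y) i = (pt ν q) i - red n y i := by
    simp only [Pi.sub_apply, Pi.add_apply]; rw [hns]; linarith
  rw [e, hpt]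
  split_ifs with hi
  · rw [abs_le]; push_cast; constructor <;> linarith
  · rw [add_zero, abs_le]; push_cast; constructor <;> linarith

/-- [folklore] `‖y − x″‖∞ ≤ 2n` from the coordinate bounds `|x″ i − y i| ≤ 2n`. -/
theorem supNorm_sub_le_of_coord {n : ℕ} {y x'' : Pt} (h : ∀ i, |x'' i - y i| ≤ ((2 * n : ℕ) : ℤ)) :
    (supNorm (y - x'') : ℝ) ≤ ((2 * n : ℕ) : ℝ) := by
  have : supNorm (y - x'') ≤ 2 * n := by
    rw [supNorm_le_iff]
    intro i
    have hi := h i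
    rw [abs_le] at hi
    refine natAbs_le_iff_mem.mpr ⟨?_, ?_⟩ <;> simp only [Pi.sub_apply] <;> push_cast <;> omega
  exact_mod_cast this

/-- **(OSC) THE WITHIN-BLOCK OSCILLATION OF THE LEG** [our bookkeeping]: the leg at the fine bond `(y, ν)` differs from its own contour-block
average (the coarse covariance column of the block `quo n y`) by a degree-3 profile with one power of `n` GAINED over (A0):
`|axialAvg n β (t ↦ P ν β (y − t)) v − axialAvg n ν (y′ ↦ axialAvg n β (t ↦ P ν β (y′ − t)) v) (quo n y)| ≤ (13824·531442·C₁∕n²)∕(‖v − quo n y‖∞+1)³`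
— each contour-block point is within `2n` of `y` coordinatewise, a lattice path of unit steps each bounded by PART 3's difference profile
(`abs_taylor0D_le`), and the fine profile converts to the coarse one (§1). -/
theorem leg_osc_letter {P : Fin 4 → Fin 4 → Pt → ℝ} {C₁ : ℝ}
    (hP1 : ∀ μ α (i : Fin 4) z, |P μ α (z + Pi.single i 1) - P μ α z| ≤ C₁ / ((supNorm z : ℝ) + 1) ^ 3)
    {n : ℕ} (hn : 1 ≤ n) (ν : Fin 4) (y : Pt) (β : Fin 4) (v : Pt) :
    |axialAvg n β (fun t => P ν β (y - t)) v
        - axialAvg n ν (fun y' => axialAvg n β (fun t => P ν β (y' - t)) v) (quo n y)|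
      ≤ (13824 * 531442 * C₁ / (n : ℝ) ^ 2) / ((supNorm (v - quo n y) : ℝ) + 1) ^ 3 := by
  have hn0 : (0 : ℝ) < n := by exact_mod_cast hn
  have hC : 0 ≤ C₁ := letter_nonneg_of_le (K := fun z => P ν β (z + Pi.single 0 1) - P ν β z) (hP1 ν β 0)
  set f : Pt → ℝ := fun y' => axialAvg n β (fun t => P ν β (y' - t)) v with hf
  set d : ℝ := (((2 * n : ℕ) : ℝ)) + 1 + supNorm (y - n • v) with hd
  have hd0 : 0 < d := by positivity
  -- the uniform step bound on the box of radius `2n` around `y`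
  set B : ℝ := 8 * (3 ^ (2 + 1) * 531442 * C₁) / d ^ 3 with hB
  have hBnn : 0 ≤ B := by positivity
  have hstep : ∀ x'' : Pt, (∀ i, |x'' i - y i| ≤ ((2 * n : ℕ) : ℤ)) →
      ∀ i : Fin 4, |Δ_[Pi.single i 1] f x''| ≤ B := by
    intro x'' hx'' i
    rw [fwdDiff, hf]
    have h1 := abs_axialAvg_fwdDiff_le_profile (a := 2) (by norm_num) i (hP1 ν β i) hn β x'' v
    refine h1.trans ?_
    -- `d ≤ 2·(2n+1+‖x″ − n•v‖)` since `‖y − n•v‖ ≤ ‖y − x″‖ + ‖x″ − n•v‖ ≤ 2n + ‖x″ − n•v‖`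
    set d'' : ℝ := (((2 * n : ℕ) : ℝ)) + 1 + supNorm (x'' - n • v) with hd''
    have hyx : (supNorm (y - x'') : ℝ) ≤ ((2 * n : ℕ) : ℝ) := supNorm_sub_le_of_coord hx''
    have htri : (supNorm (y - n • v) : ℝ) ≤ supNorm (y - x'') + supNorm (x'' - n • v) := by
      have := supNorm_add_le_real (y - x'') (x'' - n • v)
      rwa [show y - x'' + (x'' - n • v) = y - n • v by abel] at this
    have hdd : d ≤ 2 * d'' := by rw [hd, hd'']; linarith [(Nat.cast_nonneg (2 * n) : (0 : ℝ) ≤ ((2 * n : ℕ) : ℝ))]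
    have hd''0 : 0 < d'' := by positivity
    rw [hB, div_le_div_iff₀ (by positivity) (by positivity)]
    calc 3 ^ (2 + 1) * 531442 * C₁ * d ^ 3 ≤ 3 ^ (2 + 1) * 531442 * C₁ * (2 * d'') ^ 3 := by gcongr
      _ = 8 * (3 ^ (2 + 1) * 531442 * C₁) * d'' ^ 3 := by ring
  -- each contour-block point: `|f y − f y′| ≤ 4·(2n)·B`
  have hpt : ∀ q ∈ idx n, |f y - f (n • quo n y + pt ν q)| ≤ 4 * ((2 * n : ℕ) : ℝ) * B := by
    intro q hq
    have hs : ∀ i, |(n • quo n y + pt ν q - y) i| ≤ ((2 * n : ℕ) : ℤ) := abs_contour_sub_le hn y ν hq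
    have h := abs_taylor0D_le f y (n • quo n y + pt ν q - y) hs hBnn hstep
    rw [add_sub_cancel] at h
    rwa [abs_sub_comm] at h
  -- the block average of the differences
  have hcard : ((idx n).card : ℝ) = (n : ℝ) ^ 5 := by rw [card_idx]; push_cast; ring
  have hn5 : (0 : ℝ) < (n : ℝ) ^ 5 := by positivity
  have hconst : (∑ _q ∈ idx n, f y) = (n : ℝ) ^ 5 * f y := by rw [Finset.sum_const, nsmul_eq_mul, hcard]
  have e : f y - axialAvg n ν f (quo n y) = (∑ q ∈ idx n, (f y - f (n • quo n y + pt ν q))) / (n : ℝ) ^ 5 := by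
    rw [Finset.sum_sub_distrib, hconst, sub_div, mul_div_cancel_left₀ _ hn5.ne']
    rfl
  have hosc_fine : |f y - axialAvg n ν f (quo n y)| ≤ 4 * ((2 * n : ℕ) : ℝ) * B := by
    rw [e, abs_div, abs_of_pos hn5, div_le_iff₀ hn5]
    refine (Finset.abs_sum_le_sum_abs _ _).trans ?_
    calc ∑ q ∈ idx n, |f y - f (n • quo n y + pt ν q)| ≤ ∑ _q ∈ idx n, 4 * ((2 * n : ℕ) : ℝ) * B := Finset.sum_le_sum hpt
      _ = 4 * ((2 * n : ℕ) : ℝ) * B * (n : ℝ) ^ 5 := by rw [Finset.sum_const, nsmul_eq_mul, hcard, mul_comm]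
  -- `4·2n·B = 1728·531442·C₁·n / d³`, then fine ⟹ coarse
  have hfin : 4 * ((2 * n : ℕ) : ℝ) * B = (1728 * 531442 * C₁ * (n : ℝ)) / d ^ 3 := by
    rw [hB]; push_cast; field_simp; ring
  have hco := fine_le_coarse hn y v 3 (c := 1728 * 531442 * C₁ * (n : ℝ)) (by positivity)
  rw [← hd] at hco
  have hfy : f y = axialAvg n β (fun t => P ν β (y - t)) v := rfl
  rw [← hfy]
  refine (hosc_fine.trans (le_of_eq hfin)).trans (hco.trans (le_of_eq ?_))
  have hn3 : (n : ℝ) ^ 3 = (n : ℝ) ^ 2 * n := by ring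
  rw [hn3]
  field_simp
  ring

/-! ## §4 (W), (T0), (T1) for `R^Q = A·G·Aᵀ` at the axial block average -/

section RemQ

variable {P : Fin 4 → Fin 4 → Pt → ℝ} {C₀ C₁ κ : ℝ} {G : Fin 4 → Fin 4 → Pt → Pt → ℝ} {n : ℕ}

/-- **(W) THE MULTIPLIER LETTER OF THE BF ONE SHOT** [our bookkeeping]: under (P1), (G-poly) and (G-inv),
`|Σ'_v Σ_β G α β u v · axialAvg n β (t ↦ P ν β (y − t)) v| ≤ (4·1296·κ·(13824·531442·C₁∕n²) + 1)∕(‖u − quo n y‖∞+1)³`. -/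
theorem abs_multQ_le
    (hP1 : ∀ μ α (i : Fin 4) z, |P μ α (z + Pi.single i 1) - P μ α z| ≤ C₁ / ((supNorm z : ℝ) + 1) ^ 3)
    (hn : 1 ≤ n)
    (hG : ∀ α β u v, |G α β u v| ≤ κ / ((supNorm (u - v) : ℝ) + 1) ^ 5)
    (hinv : ∀ (w : Pt) (ν α : Fin 4) (u : Pt), HasSum
      (fun v => ∑ β, G α β u v * axialAvg n ν (fun y' => axialAvg n β (fun t => P ν β (y' - t)) v) w)
      (if u = w ∧ α = ν then 1 else 0))
    (ν : Fin 4) (y : Pt) (α : Fin 4) (u : Pt) :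
    |∑' v, ∑ β, G α β u v * axialAvg n β (fun t => P ν β (y - t)) v|
      ≤ ((Fintype.card (Fin 4) : ℝ) * 1296 * κ * (13824 * 531442 * C₁ / (n : ℝ) ^ 2) + 1)
          / ((supNorm (u - quo n y) : ℝ) + 1) ^ 3 :=
  abs_mult_le (b := fun β v => axialAvg n β (fun t => P ν β (y - t)) v)
    (c := fun β v => axialAvg n ν (fun y' => axialAvg n β (fun t => P ν β (y' - t)) v) (quo n y))
    hG (fun β v => leg_osc_letter hP1 hn ν y β v) (hinv (quo n y) ν) α u

/-- **(T0) `R^Q` IS `O(n⁻²)` UNIFORMLY** [our bookkeeping]: under (P0), (P1), (G-poly), (G-inv), for ALL fine bonds `(x,μ)`, `(y,ν)`,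
`|Σ'_u Σ_α axialAvg n α (v ↦ P μ α (x−v)) u · Σ'_v Σ_β G α β u v · axialAvg n β (t ↦ P ν β (y−t)) v|
   ≤ 4·162·(36·531442·C₀∕n²)·(4·1296·κ·(13824·531442·C₁∕n²) + 1)` — with IR-2's `κ ≍ n²` this is `C·n⁻²`, E-FP-5-2's EXACT power. -/
theorem abs_remQ_le
    (hP0 : ∀ μ α z, |P μ α z| ≤ C₀ / ((supNorm z : ℝ) + 1) ^ 2)
    (hP1 : ∀ μ α (i : Fin 4) z, |P μ α (z + Pi.single i 1) - P μ α z| ≤ C₁ / ((supNorm z : ℝ) + 1) ^ 3)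
    (hn : 1 ≤ n)
    (hG : ∀ α β u v, |G α β u v| ≤ κ / ((supNorm (u - v) : ℝ) + 1) ^ 5)
    (hinv : ∀ (w : Pt) (ν α : Fin 4) (u : Pt), HasSum
      (fun v => ∑ β, G α β u v * axialAvg n ν (fun y' => axialAvg n β (fun t => P ν β (y' - t)) v) w)
      (if u = w ∧ α = ν then 1 else 0))
    (μ ν : Fin 4) (x y : Pt) :
    Summable (fun u => ∑ α, axialAvg n α (fun v => P μ α (x - v)) u
        * ∑' v, ∑ β, G α β u v * axialAvg n β (fun t => P ν β (y - t)) v)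
      ∧ |∑' u, ∑ α, axialAvg n α (fun v => P μ α (x - v)) u
          * ∑' v, ∑ β, G α β u v * axialAvg n β (fun t => P ν β (y - t)) v|
        ≤ (Fintype.card (Fin 4) : ℝ) * 162 * (36 * 531442 * C₀ / (n : ℝ) ^ 2)
            * ((Fintype.card (Fin 4) : ℝ) * 1296 * κ * (13824 * 531442 * C₁ / (n : ℝ) ^ 2) + 1) :=
  abs_rem_le_of_letters (s := 2) le_rfl (fun α u => leg_letter hP0 hn μ x α u) hG
    (fun β v => leg_osc_letter hP1 hn ν y β v) (hinv (quo n y) ν)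

/-- **(T1) THE x-DIFFERENCE OF `R^Q` IS `O(n⁻³)` UNIFORMLY** [our bookkeeping]: for every lattice direction `i`,
`|R^Q((x+e_i,μ),(y,ν)) − R^Q((x,μ),(y,ν))| ≤ 4·162·(216·531442·C₁∕n³)·(4·1296·κ·(13824·531442·C₁∕n²) + 1)`. -/
theorem abs_remQ_sub_le
    (hP0 : ∀ μ α z, |P μ α z| ≤ C₀ / ((supNorm z : ℝ) + 1) ^ 2)
    (hP1 : ∀ μ α (i : Fin 4) z, |P μ α (z + Pi.single i 1) - P μ α z| ≤ C₁ / ((supNorm z : ℝ) + 1) ^ 3)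
    (hn : 1 ≤ n)
    (hG : ∀ α β u v, |G α β u v| ≤ κ / ((supNorm (u - v) : ℝ) + 1) ^ 5)
    (hinv : ∀ (w : Pt) (ν α : Fin 4) (u : Pt), HasSum
      (fun v => ∑ β, G α β u v * axialAvg n ν (fun y' => axialAvg n β (fun t => P ν β (y' - t)) v) w)
      (if u = w ∧ α = ν then 1 else 0))
    (μ ν : Fin 4) (x y : Pt) (i : Fin 4) :
    |(∑' u, ∑ α, axialAvg n α (fun v => P μ α (x + Pi.single i 1 - v)) u
          * ∑' v, ∑ β, G α β u v * axialAvg n β (fun t => P ν β (y - t)) v)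
      - (∑' u, ∑ α, axialAvg n α (fun v => P μ α (x - v)) u
          * ∑' v, ∑ β, G α β u v * axialAvg n β (fun t => P ν β (y - t)) v)|
        ≤ (Fintype.card (Fin 4) : ℝ) * 162 * (216 * 531442 * C₁ / (n : ℝ) ^ 3)
            * ((Fintype.card (Fin 4) : ℝ) * 1296 * κ * (13824 * 531442 * C₁ / (n : ℝ) ^ 2) + 1) := by
  -- the shifted leg has the same (A0) letter about the SAME block `quo n x` up to the factor in `fine_le_coarse`; we use the two-term
  -- combination lemma with legs indexed by `Fin 2`, coefficients `(1, −1)`.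
  set W : Fin 4 → Pt → ℝ := fun α u => ∑' v, ∑ β, G α β u v * axialAvg n β (fun t => P ν β (y - t)) v with hW
  have hWle : ∀ α u, |W α u| ≤ ((Fintype.card (Fin 4) : ℝ) * 1296 * κ * (13824 * 531442 * C₁ / (n : ℝ) ^ 2) + 1)
      / ((supNorm (u - quo n y) : ℝ) + 1) ^ 3 := fun α u => abs_multQ_le hP1 hn hG hinv ν y α u
  -- both legs carry a degree-2 letter centred at `quo n x` (the shifted one through its difference letter + (A0))
  set leg : Fin 2 → Fin 4 → Pt → ℝ := fun k α u =>
    if k = 0 then axialAvg n α (fun v => P μ α (x + Pi.single i 1 - v)) u else axialAvg n α (fun v => P μ α (x - v)) u with hleg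
  have hC0 : 0 ≤ C₀ := letter_nonneg_of_le (hP0 μ 0)
  have hC1 : 0 ≤ C₁ := letter_nonneg_of_le (K := fun z => P μ 0 (z + Pi.single i 1) - P μ 0 z) (hP1 μ 0 i)
  have hn0 : (0 : ℝ) < n := by exact_mod_cast hn
  have hlegle : ∀ k α u, |leg k α u| ≤ (36 * 531442 * C₀ / (n : ℝ) ^ 2 + 216 * 531442 * C₁ / (n : ℝ) ^ 3)
      / ((supNorm (u - quo n x) : ℝ) + 1) ^ 2 := by
    intro k α u
    have h0 := leg_letter hP0 hn μ x α u
    have h1 := leg_diff_letter hP1 hn μ x i α u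
    set m : ℝ := (supNorm (u - quo n x) : ℝ) + 1 with hm
    have hm1 : 1 ≤ m := one_le_supNorm_add_one _
    have hm0 : 0 < m := by positivity
    have h1' : |axialAvg n α (fun v => P μ α (x + Pi.single i 1 - v)) u - axialAvg n α (fun v => P μ α (x - v)) u|
        ≤ (216 * 531442 * C₁ / (n : ℝ) ^ 3) / m ^ 2 := by
      refine h1.trans (div_le_div_of_nonneg_left (by positivity) (by positivity) ?_)
      exact pow_le_pow_right₀ hm1 (by norm_num)
    have hadd : (36 * 531442 * C₀ / (n : ℝ) ^ 2 + 216 * 531442 * C₁ / (n : ℝ) ^ 3) / m ^ 2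
        = (36 * 531442 * C₀ / (n : ℝ) ^ 2) / m ^ 2 + (216 * 531442 * C₁ / (n : ℝ) ^ 3) / m ^ 2 := add_div _ _ _
    rw [hadd]
    fin_cases k
    · simp only [hleg, Fin.zero_eta, Fin.isValue, ↓reduceIte]
      calc |axialAvg n α (fun v => P μ α (x + Pi.single i 1 - v)) u|
          = |axialAvg n α (fun v => P μ α (x - v)) u
              + (axialAvg n α (fun v => P μ α (x + Pi.single i 1 - v)) u - axialAvg n α (fun v => P μ α (x - v)) u)| := by
            rw [add_sub_cancel]
        _ ≤ _ := (abs_add_le _ _).trans (add_le_add h0 h1')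
    · simp only [hleg, Fin.mk_one, Fin.isValue, one_ne_zero, ↓reduceIte]
      exact h0.trans (le_add_of_nonneg_right (by positivity))
  have hcomb : ∀ α u, |∑ k : Fin 2, (if k = 0 then (1 : ℝ) else -1) * leg k α u|
      ≤ (216 * 531442 * C₁ / (n : ℝ) ^ 3) / ((supNorm (u - quo n x) : ℝ) + 1) ^ 3 := by
    intro α u
    rw [Fin.sum_univ_two]
    simp only [hleg, Fin.isValue, ↓reduceIte, one_ne_zero, one_mul, neg_one_mul, ← sub_eq_add_neg]
    exact leg_diff_letter hP1 hn μ x i α u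
  have h := abs_sum_rem_le_of_letters (fun k : Fin 2 => if k = 0 then (1 : ℝ) else -1) leg (W := W) (s := 3) (by norm_num)
    hlegle hcomb hWle
  rw [Fin.sum_univ_two] at h
  simpa only [hleg, hW, Fin.isValue, ↓reduceIte, one_ne_zero, one_mul, neg_one_mul, ← sub_eq_add_neg] using h

/-- **(T0) FROM THE EXPONENTIAL COARSE-INVERSE LETTER, WITH THE POWER OF `n` EXPLICIT** [our bookkeeping]: if IR-2 delivers
`|G α β u v| ≤ K·n²·e^{−δ‖u−v‖∞}` (the inverse of the MASS-ONE coarse covariance `C_n ≍ n⁻²`), then for ALL fine bonds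
`|R^Q((x,μ),(y,ν))| ≤ (4·162·36·531442·C₀·(4·1296·(K·e^δ·5!∕δ⁵)·13824·531442·C₁ + 1)) ∕ n²` — a constant FREE of `n` over `n²`:
E-FP-5-2's `n^{2−d}` at `d = 4`, global in `(x, y)`. -/
theorem abs_remQ_le_exp {K δ : ℝ} (hδ : 0 < δ) (hK : 0 ≤ K)
    (hP0 : ∀ μ α z, |P μ α z| ≤ C₀ / ((supNorm z : ℝ) + 1) ^ 2)
    (hP1 : ∀ μ α (i : Fin 4) z, |P μ α (z + Pi.single i 1) - P μ α z| ≤ C₁ / ((supNorm z : ℝ) + 1) ^ 3)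
    (hn : 1 ≤ n)
    (hGexp : ∀ α β u v, |G α β u v| ≤ K * (n : ℝ) ^ 2 * Real.exp (-(δ * supNorm (u - v))))
    (hinv : ∀ (w : Pt) (ν α : Fin 4) (u : Pt), HasSum
      (fun v => ∑ β, G α β u v * axialAvg n ν (fun y' => axialAvg n β (fun t => P ν β (y' - t)) v) w)
      (if u = w ∧ α = ν then 1 else 0))
    (μ ν : Fin 4) (x y : Pt) :
    |∑' u, ∑ α, axialAvg n α (fun v => P μ α (x - v)) u
          * ∑' v, ∑ β, G α β u v * axialAvg n β (fun t => P ν β (y - t)) v|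
        ≤ (4 * 162 * (36 * 531442 * C₀)
            * (4 * 1296 * (K * (Real.exp δ * (Nat.factorial 5) / δ ^ 5)) * (13824 * 531442 * C₁) + 1)) / (n : ℝ) ^ 2 := by
  have hn0 : (0 : ℝ) < n := by exact_mod_cast hn
  have hKn : 0 ≤ K * (n : ℝ) ^ 2 := by positivity
  have hGp : ∀ α β u v, |G α β u v|
      ≤ (K * (n : ℝ) ^ 2 * (Real.exp δ * (Nat.factorial 5) / δ ^ 5)) / ((supNorm (u - v) : ℝ) + 1) ^ 5 :=
    fun α β u v => (hGexp α β u v).trans (LatticeConvolutionBounds.exp_neg_supNorm_le_div_pow hδ hKn 5 (u - v))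
  have h := (abs_remQ_le hP0 hP1 hn hGp hinv μ ν x y).2
  refine h.trans (le_of_eq ?_)
  simp only [Fintype.card_fin]
  push_cast
  field_simp

end RemQ

end

end Summit.QuantumFields.BalabanUV.Beta.FP.BlockAveragedRemainderAxial
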